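import Literature.NumberTheory.PAdicHodge.KummerUnitExponentClass
import HarnessLib

/-!
# The `p`-adic Kummer class `κ_∞(u) ∈ H¹(G_F, ℤ_p(1))` is represented by the cocycle `σ ↦ (ζ_{pᵏ}^{a(σ) mod pᵏ})_k`

Topic `Literature/NumberTheory/PAdicHodge`; namespace `Literature.NumberTheory.PAdicHodge.BdRPlusTop`. Sequel of
`KummerUnitExponentClass` (levelwise) at the level of the `p`-adic Tate module `ℤ_p(1) = lim_k μ_{pᵏ}` of the tree
(`GaloisCohomology/LocalInvariantMapPadic`: `muPadicSystem`, `tateModuleMuPadic`; `GaloisCohomology/KummerMapPadic`: `kummerPadic`).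

For `u ∈ F`, `u ≠ 0`, with root system `(u_k)_k = rootSeq p u`:

* `epsRaw_pow_pow_sub` — `ζ_{pᵐ}^{p^{m−k}} = ζ_{pᵏ}` for the compatible system `epsRaw` defining Fontaine's `ε`;
* `rootKummerCocycleLevel u k` — the connecting cocycle `σ ↦ σ(u_k)/u_k ∈ μ_{pᵏ}` of the chosen root (a `contOneCocycles`);
  `redCocycle₁_rootKummerCocycleLevel` — these are COMPATIBLE under the power maps `μ_{pᵐ} ↠ μ_{pᵏ}`;
* ★ `rootKummerCocycle u : contOneCocycles (ℤ_p(1))` — their limit (tree `DiscreteInvSystem.limitCocycle₁`), with components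
  `σ(u_k)/u_k = ζ_{pᵏ}^{(a(σ) mod pᵏ)}` (`coe_muVal_rootKummerCocycle_apply`, `a(σ) = kummerExp σ ∈ ℤ_p` of `BdRKummerUnitPeriod`);
* ★★ `oneCocycleClass_rootKummerCocycle` — **its class IS `κ_∞(u) = kummerPadic F p u`** (uniqueness from the levels,
  `eq_kummerPadic_of_proj`, and `kummerLevel_eq_oneCocycleClass_rootSeq`).

So the transformation law `(σ − 1) ℓ_u = a(σ)·t` of `BdRKummerUnitPeriod.gal_kummerUnitLog_eq` is, verbatim, «`κ_∞(u) ⊗ (ε ↦ t)` is the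
coboundary of `ℓ_u ∈ Fil¹B_dR⁺`» for the tree's own `κ_∞` — Bloch–Kato Ex. 3.10.1 for `𝔾_m` at the cochain level (input (H5) of
`Cruxes/StarredOptimalManinUnitFiveSeven/Lines/kato-lever-K3-B2-road.md`). Definitions (reviewed): `rootKummerCocycleLevel`,
`rootKummerCocycle`. No named fact, no instance, no `sorry`. Crux K★ `stmt-BirchSwinnertonDyer-22226`; BSD / K★ not proved by this.

## References
* K. Kato, LNM 1553 (1993), Ch. II 1.4.2 (`κ` as the limit of the Kummer connecting maps). [Kato1993LNM1553]
* S. Bloch, K. Kato (1990), Ex. 3.10.1. [BlochKato1990]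
* J. Neukirch, A. Schmidt, K. Wingberg (2008), II §7 Thm. 2.7.5. [NeukirchSchmidtWingberg2008]
-/

noncomputable section

open Field

namespace Literature.NumberTheory.PAdicHodge

namespace BdRPlusTop

open Literature.NumberTheory.GaloisRepresentations
open Literature.NumberTheory.GaloisRepresentations.IsNonarchimedeanLocalField
open Literature.NumberTheory.GaloisRepresentations.DiscreteGaloisModule
open Literature.NumberTheory.GaloisCohomology
open Literature.AnabelianGeometry.AbsoluteAnabelian
open Literature.AnabelianGeometry.AbsoluteAnabelian.Prop121vii (baseUnitsInvariant)

variable {F : Type} [Field F] [ValuativeRel F] [TopologicalSpace F] [IsNonarchimedeanLocalField F] [CharZero F]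
  {p : ℕ} [Fact p.Prime]

omit [CharZero F] [Fact p.Prime] in
/-- `u ≠ 0` read in the normed algebraic closure. [folklore] -/
private theorem algebraMap_normedAlgClosure_ne_zero' {u : F} (hu : u ≠ 0) :
    (algebraMap F (NormedAlgClosure F) u) ≠ 0 :=
  (map_ne_zero_iff _ (algebraMap F (NormedAlgClosure F)).injective).2 hu

/-- **`ζ_{pᵐ}^{p^{m−k}} = ζ_{pᵏ}`** for the compatible system `epsRaw` (`ζ_{p^{j+1}}^p = ζ_{pʲ}` iterated).
[cite: FontaineOuyang2022, §4.3] -/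
theorem epsRaw_pow_pow_sub {k m : ℕ} (h : k ≤ m) : (epsRaw p m : NormedAlgClosure F) ^ p ^ (m - k) = epsRaw p k := by
  obtain ⟨j, rfl⟩ := Nat.exists_eq_add_of_le h
  rw [Nat.add_sub_cancel_left]
  clear h
  induction j with
  | zero => rw [pow_zero, pow_one, Nat.add_zero]
  | succ j ih => rw [pow_succ', pow_mul, ← Nat.add_assoc, epsRaw_succ_pow, ih]

omit [CharZero F] in
/-- `u_m ^ p^{m−k} = u_k` for the root system. [cite: FontaineAsterisque223III, Exp. II §1.2.2] -/
theorem rootSeq_pow_pow_sub (u : NormedAlgClosure F) {k m : ℕ} (h : k ≤ m) : rootSeq p u m ^ p ^ (m - k) = rootSeq p u k := by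
  obtain ⟨j, rfl⟩ := Nat.exists_eq_add_of_le h
  rw [Nat.add_sub_cancel_left]
  clear h
  induction j with
  | zero => rw [pow_zero, pow_one, Nat.add_zero]
  | succ j ih => rw [pow_succ', pow_mul, ← Nat.add_assoc, rootSeq_succ_pow, ih]

variable (p) in
/-- **The level-`k` Kummer cocycle `σ ↦ σ(u_k)/u_k ∈ μ_{pᵏ}(F̄)`** of `u ∈ Fˣ` for the CHOSEN root `u_k = rootSeq p u k`
(the tree's connecting cocycle `IsSES.δ₀Cocycle` of the Kummer sequence at the lift `u_k`). [cite: SerreGaloisCohomology1997, II §1.2] -/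
def rootKummerCocycleLevel {u : F} (hu : u ≠ 0) (k : ℕ) : contOneCocycles (mu F (p ^ k)).toTopRep :=
  (isSES_kummer F (p ^ k) (pow_pos (Fact.out : p.Prime).pos k)).δ₀Cocycle
    (UnitsCarrier.ofUnits (Units.mk0 _ (rootSeq_toAlgClosure_ne_zero p hu k))) (kummerπ_rootUnitsCarrier_mem_invariants hu k)

/-- Values of the level cocycle: `σ(u_k)/u_k = ζ_{pᵏ}^{(a(σ) mod pᵏ)}`. [cite: SerreGaloisCohomology1997, II §1.2] [cite: BlochKato1990, Ex. 3.10.1] -/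
theorem coe_muVal_rootKummerCocycleLevel {u : F} (hu : u ≠ 0) (k : ℕ) (σ : absoluteGaloisGroup F) :
    ((muVal F (p ^ k) ((rootKummerCocycleLevel p hu k).1 σ) : (AlgebraicClosure F)ˣ) : AlgebraicClosure F) =
      NormedAlgClosure.toAlgClosure (epsRaw p k) ^
        (PadicInt.toZModPow k (kummerExp (p := p) σ (algebraMap_normedAlgClosure_ne_zero' hu)
          (NormedAlgClosure.smul_algebraMap σ u))).val :=
  coe_muVal_δ₀Cocycle_rootSeq_eq_epsRaw_pow_toZModPow hu σ k

omit [CharZero F] in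
/-- The class of the level cocycle is `κ_{pᵏ}(u)`. [cite: SerreGaloisCohomology1997, II §1.2] -/
theorem oneCocycleClass_rootKummerCocycleLevel {u : F} (hu : u ≠ 0) (k : ℕ) :
    oneCocycleClass _ (rootKummerCocycleLevel p hu k) = kummerLevel F (p ^ k) (pow_pos (Fact.out : p.Prime).pos k) u hu :=
  (kummerLevel_eq_oneCocycleClass_rootSeq hu k).symm

/-- **Compatibility under `μ_{pᵐ} ↠ μ_{pᵏ}`, `ζ ↦ ζ^{p^{m−k}}`**: `(σ(u_m)/u_m)^{p^{m−k}} = σ(u_k)/u_k`.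
[cite: Kato1993LNM1553, Ch. II 1.4.2] [cite: NeukirchSchmidtWingberg2008, II §7 Thm 2.7.5] -/
theorem redCocycle₁_rootKummerCocycleLevel {u : F} (hu : u ≠ 0) {k m : ℕ} (h : k ≤ m) :
    (muPadicSystem F p).redCocycle₁ h (rootKummerCocycleLevel p hu m) = rootKummerCocycleLevel p hu k := by
  haveI : NeZero (p ^ k) := ⟨pow_ne_zero k (Fact.out : p.Prime).ne_zero⟩
  refine Subtype.ext (ContinuousMap.ext fun σ => muVal_injective F _ (Units.ext ?_))
  rw [DiscreteInvSystem.redCocycle₁_apply, muPadicSystem_red, muVal_muPow, Units.val_pow_eq_pow_val,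
    coe_muVal_rootKummerCocycleLevel, coe_muVal_rootKummerCocycleLevel, ← pow_mul, mul_comm, pow_mul,
    ← map_pow (NormedAlgClosure.toAlgClosure (F := F)), epsRaw_pow_pow_sub h]
  exact pow_eq_pow_of_modEq (by rw [← map_pow, epsRaw_pow, map_one]) (toZModPow_val_modEq _ h)

variable (p) in
/-- ★ **The `p`-adic Kummer cocycle `σ ↦ (σ(u_k)/u_k)_k ∈ ℤ_p(1) = lim_k μ_{pᵏ}`** of `u ∈ Fˣ` (limit of the compatible level
cocycles, tree `DiscreteInvSystem.limitCocycle₁`). [cite: Kato1993LNM1553, Ch. II 1.4.2] [cite: NeukirchSchmidtWingberg2008, II §7 Thm 2.7.5] -/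
def rootKummerCocycle {u : F} (hu : u ≠ 0) : contOneCocycles (tateModuleMuPadic F p).toTopRep :=
  (muPadicSystem F p).limitCocycle₁ (fun k => rootKummerCocycleLevel p hu k) (fun h => redCocycle₁_rootKummerCocycleLevel hu h)

/-- Components of the `p`-adic Kummer cocycle. [cite: Kato1993LNM1553, Ch. II 1.4.2] -/
@[simp] theorem projCocycle₁_rootKummerCocycle {u : F} (hu : u ≠ 0) (k : ℕ) :
    (muPadicSystem F p).projCocycle₁ k (rootKummerCocycle p hu) = rootKummerCocycleLevel p hu k :=
  (muPadicSystem F p).projCocycle₁_limitCocycle₁ _ _ k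

/-- ★ **Values: the `k`-th component of the `p`-adic Kummer cocycle at `σ` is `ζ_{pᵏ}^{(a(σ) mod pᵏ)}`**, `a(σ) = kummerExp σ ∈ ℤ_p`
— i.e. the cocycle is `σ ↦ a(σ)·ε` in the basis `ε = (ζ_{pᵏ})_k` of `ℤ_p(1)`. [cite: BlochKato1990, Ex. 3.10.1] [cite: Kato1993LNM1553, Ch. II 1.4.2] -/
theorem coe_muVal_rootKummerCocycle_apply {u : F} (hu : u ≠ 0) (σ : absoluteGaloisGroup F) (k : ℕ) :
    ((muVal F (p ^ k) (((rootKummerCocycle p hu).1 σ : ∀ k, MuCarrier F (p ^ k)) k) : (AlgebraicClosure F)ˣ) :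
        AlgebraicClosure F) =
      NormedAlgClosure.toAlgClosure (epsRaw p k) ^
        (PadicInt.toZModPow k (kummerExp (p := p) σ (algebraMap_normedAlgClosure_ne_zero' hu)
          (NormedAlgClosure.smul_algebraMap σ u))).val := by
  rw [← DiscreteInvSystem.projCocycle₁_apply, projCocycle₁_rootKummerCocycle, coe_muVal_rootKummerCocycleLevel]

/-- ★★ **The class of the `p`-adic Kummer cocycle is `κ_∞(u) = kummerPadic F p u`** (uniqueness of `κ_∞` from its levels,
`eq_kummerPadic_of_proj`). Hence every statement about `κ_∞(u)` may be read on the explicit cocycle `σ ↦ (ζ_{pᵏ}^{a(σ) mod pᵏ})_k`,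
and the `B_dR⁺`-law `(σ − 1)ℓ_u = a(σ)·t` (`gal_kummerUnitLog_eq`) says that `κ_∞(u)`, pushed along `ℤ_p(1) → t·B_dR⁺` (`ε ↦ t`), is
the coboundary of `ℓ_u`. [cite: Kato1993LNM1553, Ch. II 1.4.2] [cite: BlochKato1990, Ex. 3.10.1] -/
theorem oneCocycleClass_rootKummerCocycle {u : F} (hu : u ≠ 0) :
    oneCocycleClass _ (rootKummerCocycle p hu) = kummerPadic F p u hu :=
  eq_kummerPadic_of_proj F p u hu _ fun k => by
    rw [DiscreteInvSystem.cohomologyMap_projHom_oneCocycleClass, projCocycle₁_rootKummerCocycle,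
      oneCocycleClass_rootKummerCocycleLevel]

end BdRPlusTop

end Literature.NumberTheory.PAdicHodge

end
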